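import Summits.AtomisticToContinuum.HydrodynamicLimit.Theorems.OneSphereInfluenceAssemblyScoreCovariance
import Summits.AtomisticToContinuum.HydrodynamicLimit.Theorems.OneSphereInfluenceAssemblyMean
import HarnessLib

/-!
# Assembly of route `OneSphereInfluence` (stmt-AtomisticToContinuum-14700): the mean–variance core

Helper file for the assembly item `…Theses.OneSphereInfluence.Assembly`: the two glue steps of
the route thesis, for ONE abstract energy-dominated observable `F_N` (the final file instantiates
it with the empirical density / momentum / energy fields at time `t`).

* `tendsto_integral_comp_flow_const` — **the `κ = 0` anchor**: under the homogeneous local Gibbs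
  law (constant profiles), invariant under every hard-sphere flow, `E F₀(Φ_t ·) = E F₀ → c₀` as soon
  as `F₀ → c₀` in probability at time `0` (uniform `L²` bound from the Gaussian velocities);
* `tendsto_integral_of_uniform_covariance` / `tendsto_measure_lt_of_uniform_covariance` /
  `tendsto_lintegral_sq_of_uniform_covariance` — **mean–variance reduction along the homotopy**:
  if along a smooth path of profiles the covariances `Cov_{p_κ^N}(S_κ^N, F_N)` converge to
  `G'(κ)` uniformly on `[0,1]` (the score linear response), `E_{p_0^N} F_N → G(0)` (anchor) and
  `Var_{p_1^N} F_N → 0` (Poincaré × resampling influence), then `E_{p_1^N} F_N → G(1)` and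
  `F_N → G(1)` in `p_1^N`-probability and in mean square: the finite-`N` score identity
  `d/dκ E_{p_κ}F = Cov(S_κ, F)` (`hasDerivAt_integral_localGibbsMeasure`), the mean value inequality
  on `[0,1]`, and Chebyshev / `E(X-c)² = Var X + (EX-c)²`.

Folklore glue; no definitions, no named facts.
-/

noncomputable section

open MeasureTheory ProbabilityTheory Filter Set Topology Real
open scoped InnerProductSpace ENNReal

namespace Summit.AtomisticToContinuum.HydrodynamicLimit.Theorems.OneSphereInfluenceAssembly

open Literature.Analysis.FluidPDE Literature.MathematicalPhysics.KineticTheory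

/-! ## The `κ = 0` anchor: invariant homogeneous law -/

/-- **Means along the flow under the invariant homogeneous law converge to the static limit.**
For constant profiles `(c, uc, θc)` (`c, θc > 0`) whose local Gibbs laws are probability
measures invariant under the flows `Φ_N`, a measurable energy-dominated time-zero observable
`F₀_N` with `F₀_N(Φ_0 ·) → c₀` in probability has `E F₀_N(Φ_t ·) → c₀` for every `t`
(invariance: `E F₀(Φ_t ·) = E F₀`; uniform integrability from the uniform `L²` bound).
[folklore] -/
theorem tendsto_integral_comp_flow_const (σ c θc : ℝ) (uc : V3) (hθc : 0 < θc) (hc : 0 ≤ c)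
    (Φ : (N : ℕ) → HardSphereFlow (Torus.geometry (Fin 3)) (hsDiameter σ N) (N + 1))
    (hinv : ∀ (N : ℕ) (t : ℝ), (Φ N).lawAt (localGibbsLaw σ (fun _ => c) (fun _ => uc) (fun _ => θc) N (Φ N)) t =
      localGibbsLaw σ (fun _ => c) (fun _ => uc) (fun _ => θc) N (Φ N))
    (hprob : ∀ N, IsProbabilityMeasure (localGibbsMeasure σ (fun _ => c) (fun _ => uc) (fun _ => θc) N))
    {F₀ : (N : ℕ) → Config (N + 1) (Fin 3) T3 → ℝ} (hFm : ∀ N, Measurable (F₀ N)) {K : ℝ} (hK : 0 ≤ K)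
    (hFb : ∀ N z, |F₀ N z| ≤ K * (1 + ((N + 1 : ℕ) : ℝ)⁻¹ * ∑ i, ‖(z i).2‖ ^ 2)) {c₀ : ℝ}
    (hlln : ∀ δ > (0 : ℝ), Tendsto (fun N => localGibbsLaw σ (fun _ => c) (fun _ => uc) (fun _ => θc) N (Φ N)
      {z | δ < |F₀ N ((Φ N).flow 0 z) - c₀|}) atTop (𝓝 0))
    (t : ℝ) :
    Tendsto (fun N => ∫ z, F₀ N ((Φ N).flow t z) ∂localGibbsMeasure σ (fun _ => c) (fun _ => uc) (fun _ => θc) N)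
      atTop (𝓝 c₀) := by
  haveI := hprob
  -- invariance: the mean at time `t` is the mean at time `0`
  have hinv' : ∀ N, ∫ z, F₀ N ((Φ N).flow t z) ∂localGibbsMeasure σ (fun _ => c) (fun _ => uc) (fun _ => θc) N =
      ∫ z, F₀ N z ∂localGibbsMeasure σ (fun _ => c) (fun _ => uc) (fun _ => θc) N := by
    intro N
    have h := hinv N t
    rw [localGibbsLaw_eq] at h
    exact integral_comp_flow_eq_of_lawAt_eq (Φ N) h (hFm N)
  simp_rw [hinv']
  -- uniform second moments
  have hmom := fun N => memLp_two_of_abs_le_energy (a₀ := fun _ => c) (θ₀ := fun _ => θc) (u₀ := fun _ => uc)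
    continuous_const continuous_const continuous_const (fun _ => hc) (fun _ => hθc)
    (U := ‖uc‖) (Θ := θc) (fun _ => le_rfl) (fun _ => le_rfl) σ N (hFm N).aestronglyMeasurable hK
    (Eventually.of_forall (hFb N))
  refine tendsto_integral_of_tendsto_measure_of_sq_le hFm (fun N => (hmom N).1) (fun N => (hmom N).2)
    fun δ hδ => ?_
  refine (hlln δ hδ).congr fun N => ?_
  exact localGibbsLaw_preimage_flow_zero σ _ _ _ N (Φ N) {z | δ < |F₀ N z - c₀|}

/-! ## Vanishing variance and converging means give mean-square convergence -/

/-- `E (X - c)² = Var X + (E X - c)²` on a probability space, for `X ∈ L²`. [folklore] -/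
theorem integral_sub_sq_eq_variance_add {Ω : Type*} [MeasurableSpace Ω] {P : Measure Ω} [IsProbabilityMeasure P]
    {X : Ω → ℝ} (hX : MemLp X 2 P) (c : ℝ) :
    ∫ ω, (X ω - c) ^ 2 ∂P = Var[X; P] + (∫ ω, X ω ∂P - c) ^ 2 := by
  have hY : MemLp (fun ω => X ω - c) 2 P := hX.sub (memLp_const c)
  have hvar := variance_eq_sub hY
  rw [variance_sub_const hX.aestronglyMeasurable] at hvar
  have hmean : ∫ ω, (X ω - c) ∂P = ∫ ω, X ω ∂P - c := by
    rw [integral_sub (hX.integrable one_le_two) (integrable_const c), integral_const, smul_eq_mul,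
      probReal_univ, one_mul]
  have h2 : ∫ ω, ((fun ω => X ω - c) ^ 2) ω ∂P = ∫ ω, (X ω - c) ^ 2 ∂P := rfl
  rw [h2, hmean] at hvar
  linarith

/-- **Vanishing variance and converging means give mean-square convergence** (as lower integrals
of `ofReal |·|²`): on probability spaces, `X_N ∈ L²`, `Var X_N → 0` and `E X_N → c` imply
`∫⁻ |X_N - c|² dP_N → 0`. [folklore] -/
theorem tendsto_lintegral_sq_sub_of_variance {Ω : ℕ → Type*} [∀ N, MeasurableSpace (Ω N)]
    {P : (N : ℕ) → Measure (Ω N)} [∀ N, IsProbabilityMeasure (P N)] {X : (N : ℕ) → Ω N → ℝ} {c : ℝ}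
    (hX : ∀ N, MemLp (X N) 2 (P N))
    (hvar : Tendsto (fun N => variance (X N) (P N)) atTop (𝓝 0))
    (hmean : Tendsto (fun N => ∫ ω, X N ω ∂P N) atTop (𝓝 c)) :
    Tendsto (fun N => ∫⁻ ω, ENNReal.ofReal (|X N ω - c| ^ 2) ∂P N) atTop (𝓝 0) := by
  have hint : ∀ N, Integrable (fun ω => (X N ω - c) ^ 2) (P N) := fun N =>
    ((hX N).sub (memLp_const c)).integrable_sq
  have heq : ∀ N, ∫⁻ ω, ENNReal.ofReal (|X N ω - c| ^ 2) ∂P N =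
      ENNReal.ofReal (Var[X N; P N] + (∫ ω, X N ω ∂P N - c) ^ 2) := by
    intro N
    rw [← integral_sub_sq_eq_variance_add (hX N) c, ofReal_integral_eq_lintegral_ofReal (hint N)
      (Eventually.of_forall fun ω => sq_nonneg _)]
    simp_rw [sq_abs]
  simp_rw [heq]
  have h : Tendsto (fun N => Var[X N; P N] + (∫ ω, X N ω ∂P N - c) ^ 2) atTop (𝓝 0) := by
    have h2 := (hmean.sub_const c).pow 2
    rw [sub_self, zero_pow two_ne_zero] at h2
    simpa using hvar.add h2
  have h' := ENNReal.tendsto_ofReal h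
  rwa [ENNReal.ofReal_zero] at h'

/-! ## Mean–variance reduction along the homotopy -/

section Path

variable {a θ₀ : ℝ → T3 → ℝ} {u₀ : ℝ → T3 → V3}
  (ha : Literature.Analysis.FunctionSpaces.Torus.IsSmoothSpaceTimeOn (Icc 0 1) a)
  (hθ : Literature.Analysis.FunctionSpaces.Torus.IsSmoothSpaceTimeOn (Icc 0 1) θ₀)
  (hu : Literature.Analysis.FunctionSpaces.Torus.IsSmoothSpaceTimeOn (Icc 0 1) u₀)
  (ha0 : ∀ κ ∈ Icc (0 : ℝ) 1, ∀ x, 0 < a κ x) (hθ0 : ∀ κ ∈ Icc (0 : ℝ) 1, ∀ x, 0 < θ₀ κ x)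
  (σ : ℝ)

/-- An observable dominated by `K (1 + (N+1)⁻¹ ∑ |vᵢ|²)` on the good set of the flow is dominated by
`K (1 + ∑ |vᵢ|²)` Lebesgue-a.e. on the hard-sphere domain. [folklore] -/
theorem ae_abs_le_of_good {N : ℕ} (Φ : HardSphereFlow (Torus.geometry (Fin 3)) (hsDiameter σ N) (N + 1))
    {K : ℝ} (hK : 0 ≤ K) {F : Config (N + 1) (Fin 3) T3 → ℝ}
    (hFb : ∀ z ∈ Φ.good, |F z| ≤ K * (1 + ((N + 1 : ℕ) : ℝ)⁻¹ * ∑ i, ‖(z i).2‖ ^ 2)) :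
    ∀ᵐ z ∂(volume : Measure (Config (N + 1) (Fin 3) T3)),
      z ∈ hardSphereDomain (Torus.geometry (Fin 3)) (N + 1) (hsDiameter σ N) →
        |F z| ≤ K * (1 + ∑ i, ‖(z i).2‖ ^ 2) := by
  filter_upwards [ae_mem_good_of_mem_hardSphereDomain Φ] with z hz hzD
  refine (hFb z (hz hzD)).trans (mul_le_mul_of_nonneg_left ?_ hK)
  have hs : 0 ≤ ∑ i, ‖(z i).2‖ ^ 2 := Finset.sum_nonneg fun i _ => by positivity
  have hn : (1 : ℝ) ≤ ((N + 1 : ℕ) : ℝ) := by exact_mod_cast Nat.succ_pos N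
  have hinv : ((N + 1 : ℕ) : ℝ)⁻¹ ≤ 1 := inv_le_one_of_one_le₀ hn
  nlinarith

include ha hθ hu ha0 hθ0 in
/-- Observables dominated on the good set are in `L²(p_κ^N)` along the path. [folklore] -/
theorem memLp_two_of_good {N : ℕ} (Φ : HardSphereFlow (Torus.geometry (Fin 3)) (hsDiameter σ N) (N + 1))
    (hprob : ∀ κ ∈ Icc (0 : ℝ) 1, IsProbabilityMeasure (localGibbsMeasure σ (a κ) (u₀ κ) (θ₀ κ) N)) {κ : ℝ}
    (hκ : κ ∈ Icc (0 : ℝ) 1)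
    {F : Config (N + 1) (Fin 3) T3 → ℝ} (hFm : Measurable F) {K : ℝ} (hK : 0 ≤ K)
    (hFb : ∀ z ∈ Φ.good, |F z| ≤ K * (1 + ((N + 1 : ℕ) : ℝ)⁻¹ * ∑ i, ‖(z i).2‖ ^ 2)) :
    MemLp F 2 (localGibbsMeasure σ (a κ) (u₀ κ) (θ₀ κ) N) :=
  memLp_two_of_ae_dom ha hθ hu ha0 hθ0 σ N hprob hκ hFm hK (ae_abs_le_of_good σ Φ hK hFb)

include ha hθ hu ha0 hθ0 in
/-- **Convergence of the means along the homotopy** (mean half of the glue `MeanVarianceL2`).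
Along a jointly smooth path of positive profiles whose local Gibbs laws are probability measures,
let `F_N` be measurable observables with `|F_N| ≤ K (1 + (N+1)⁻¹ ∑ |vᵢ|²)` on the good sets of the
flows `Φ_N`, and `G` differentiable within `[0,1]`. If `Cov_{p_κ^N}(S_κ^N, F_N) → G'(κ)` uniformly
on `[0,1]` (`S_κ^N = ∑ᵢ ∂_κ log f_κ(zᵢ)`) and `E_{p_0^N} F_N → G(0)`, then `E_{p_1^N} F_N → G(1)`:
the finite-`N` score identity `d/dκ E_{p_κ}F = Cov(S_κ,F)`, the mean value inequality on
`[0,1]` up to the endpoints, and the anchor. [folklore] -/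
theorem tendsto_integral_of_uniform_covariance
    (Φ : (N : ℕ) → HardSphereFlow (Torus.geometry (Fin 3)) (hsDiameter σ N) (N + 1))
    (hprob : ∀ κ ∈ Icc (0 : ℝ) 1, ∀ N, IsProbabilityMeasure (localGibbsMeasure σ (a κ) (u₀ κ) (θ₀ κ) N))
    {F : (N : ℕ) → Config (N + 1) (Fin 3) T3 → ℝ} (hFm : ∀ N, Measurable (F N)) {K : ℝ} (hK : 0 ≤ K)
    (hFb : ∀ N, ∀ z ∈ (Φ N).good, |F N z| ≤ K * (1 + ((N + 1 : ℕ) : ℝ)⁻¹ * ∑ i, ‖(z i).2‖ ^ 2))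
    {G : ℝ → ℝ} (hG : ∀ κ ∈ Icc (0 : ℝ) 1, DifferentiableWithinAt ℝ G (Icc 0 1) κ)
    (hcov : TendstoUniformlyOn (fun N κ => cov[fun z => ∑ i,
        derivWithin (fun κ' => Real.log (localGibbsProfile (a κ') (u₀ κ') (θ₀ κ') (z i))) (Icc 0 1) κ, F N;
        localGibbsMeasure σ (a κ) (u₀ κ) (θ₀ κ) N])
      (fun κ => derivWithin G (Icc 0 1) κ) atTop (Icc 0 1))
    (h0 : Tendsto (fun N => ∫ z, F N z ∂localGibbsMeasure σ (a 0) (u₀ 0) (θ₀ 0) N) atTop (𝓝 (G 0))) :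
    Tendsto (fun N => ∫ z, F N z ∂localGibbsMeasure σ (a 1) (u₀ 1) (θ₀ 1) N) atTop (𝓝 (G 1)) := by
  -- the observable bound, Lebesgue-a.e. on the hard-sphere domain, in the unnormalised form
  have hFb' := fun N => ae_abs_le_of_good σ (Φ N) hK (hFb N)
  have hprob' : ∀ N, ∀ κ ∈ Icc (0 : ℝ) 1, IsProbabilityMeasure (localGibbsMeasure σ (a κ) (u₀ κ) (θ₀ κ) N) :=
    fun N κ hκ => hprob κ hκ N
  -- finite-`N` score identity and continuity
  have hderiv : ∀ N, ∀ κ ∈ Ioo (0 : ℝ) 1,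
      HasDerivAt (fun κ' => ∫ z, F N z ∂localGibbsMeasure σ (a κ') (u₀ κ') (θ₀ κ') N)
        (cov[fun z => ∑ i, derivWithin (fun κ' => Real.log (localGibbsProfile (a κ') (u₀ κ') (θ₀ κ') (z i)))
          (Icc 0 1) κ, F N; localGibbsMeasure σ (a κ) (u₀ κ) (θ₀ κ) N]) κ := fun N κ hκ =>
    hasDerivAt_integral_localGibbsMeasure ha hθ hu ha0 hθ0 σ N (hprob' N) (hFm N) hK (hFb' N) hκ
  have hcont : ∀ N, ContinuousOn (fun κ' => ∫ z, F N z ∂localGibbsMeasure σ (a κ') (u₀ κ') (θ₀ κ') N) (Icc 0 1) :=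
    fun N =>
    continuousOn_integral_localGibbsMeasure ha hθ hu ha0 hθ0 σ N (hprob' N) (hFm N) hK (hFb' N)
  have hGd : ∀ κ ∈ Ioo (0 : ℝ) 1, HasDerivWithinAt G (derivWithin G (Icc 0 1) κ) (Icc 0 1) κ :=
    fun κ hκ => (hG κ (Ioo_subset_Icc_self hκ)).hasDerivWithinAt
  have hGc : ContinuousOn G (Icc 0 1) := fun κ hκ => (hG κ hκ).continuousWithinAt
  rw [Metric.tendsto_atTop]
  intro ε hε
  have hε2 : 0 < ε / 2 := half_pos hε
  obtain ⟨N₁, hN₁⟩ := eventually_atTop.1 ((Metric.tendstoUniformlyOn_iff.1 hcov) (ε / 2) hε2)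
  obtain ⟨N₀, hN₀⟩ := (Metric.tendsto_atTop.1 h0) (ε / 2) hε2
  refine ⟨max N₀ N₁, fun N hN => ?_⟩
  set E1 : ℝ := ∫ z, F N z ∂localGibbsMeasure σ (a 1) (u₀ 1) (θ₀ 1) N with hE1
  set E0 : ℝ := ∫ z, F N z ∂localGibbsMeasure σ (a 0) (u₀ 0) (θ₀ 0) N with hE0
  have hA := hN₀ N ((le_max_left _ _).trans hN)
  have hB := hN₁ N ((le_max_right _ _).trans hN)
  have hmvt := abs_sub_sub_le_of_abs_deriv_sub_le (hcont N) hGc (hderiv N) hGd (ε := ε / 2)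
    fun κ hκ => by
      have h := hB κ (Ioo_subset_Icc_self hκ)
      rw [dist_comm, Real.dist_eq] at h
      exact h.le
  rw [Real.dist_eq] at hA ⊢
  have htri : |E1 - G 1| ≤ |(E1 - E0) - (G 1 - G 0)| + |E0 - G 0| := by
    have := abs_add_le ((E1 - E0) - (G 1 - G 0)) (E0 - G 0)
    rwa [show (E1 - E0) - (G 1 - G 0) + (E0 - G 0) = E1 - G 1 by ring] at this
  linarith

include ha hθ hu ha0 hθ0 in
/-- **Mean–variance reduction along the homotopy** (the glue `MeanVarianceL2` of the route thesis,
for one abstract observable, in probability). Under the hypotheses of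
`tendsto_integral_of_uniform_covariance`, if moreover `Var_{p_1^N}(F_N) → 0` then
`p_1^N(δ < |F_N - G(1)|) → 0` for every `δ > 0` (Chebyshev). [folklore] -/
theorem tendsto_measure_lt_of_uniform_covariance
    (Φ : (N : ℕ) → HardSphereFlow (Torus.geometry (Fin 3)) (hsDiameter σ N) (N + 1))
    (hprob : ∀ κ ∈ Icc (0 : ℝ) 1, ∀ N, IsProbabilityMeasure (localGibbsMeasure σ (a κ) (u₀ κ) (θ₀ κ) N))
    {F : (N : ℕ) → Config (N + 1) (Fin 3) T3 → ℝ} (hFm : ∀ N, Measurable (F N)) {K : ℝ} (hK : 0 ≤ K)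
    (hFb : ∀ N, ∀ z ∈ (Φ N).good, |F N z| ≤ K * (1 + ((N + 1 : ℕ) : ℝ)⁻¹ * ∑ i, ‖(z i).2‖ ^ 2))
    {G : ℝ → ℝ} (hG : ∀ κ ∈ Icc (0 : ℝ) 1, DifferentiableWithinAt ℝ G (Icc 0 1) κ)
    (hcov : TendstoUniformlyOn (fun N κ => cov[fun z => ∑ i,
        derivWithin (fun κ' => Real.log (localGibbsProfile (a κ') (u₀ κ') (θ₀ κ') (z i))) (Icc 0 1) κ, F N;
        localGibbsMeasure σ (a κ) (u₀ κ) (θ₀ κ) N])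
      (fun κ => derivWithin G (Icc 0 1) κ) atTop (Icc 0 1))
    (h0 : Tendsto (fun N => ∫ z, F N z ∂localGibbsMeasure σ (a 0) (u₀ 0) (θ₀ 0) N) atTop (𝓝 (G 0)))
    (hvar : Tendsto (fun N => Var[F N; localGibbsMeasure σ (a 1) (u₀ 1) (θ₀ 1) N]) atTop (𝓝 0)) {δ : ℝ}
    (hδ : 0 < δ) :
    Tendsto (fun N => localGibbsMeasure σ (a 1) (u₀ 1) (θ₀ 1) N {z | δ < |F N z - G 1|}) atTop (𝓝 0) := by
  have hmean := tendsto_integral_of_uniform_covariance ha hθ hu ha0 hθ0 σ Φ hprob hFm hK hFb hG hcov h0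
  haveI : ∀ N, IsProbabilityMeasure (localGibbsMeasure σ (a 1) (u₀ 1) (θ₀ 1) N) :=
    hprob 1 ⟨zero_le_one, le_rfl⟩
  have hmem : ∀ N, MemLp (F N) 2 (localGibbsMeasure σ (a 1) (u₀ 1) (θ₀ 1) N) := fun N =>
    memLp_two_of_good ha hθ hu ha0 hθ0 σ (Φ N) (fun κ hκ => hprob κ hκ N) ⟨zero_le_one, le_rfl⟩ (hFm N) hK (hFb N)
  exact tendsto_measure_lt_abs_sub_of_variance hmem hvar hmean hδ

include ha hθ hu ha0 hθ0 in
/-- **Mean–variance reduction along the homotopy, in mean square** (the glue `MeanVarianceL2` of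
the route thesis, for one abstract observable). Under the hypotheses of
`tendsto_integral_of_uniform_covariance`, if moreover `Var_{p_1^N}(F_N) → 0` then
`∫⁻ |F_N - G(1)|² dp_1^N → 0`. [folklore] -/
theorem tendsto_lintegral_sq_of_uniform_covariance
    (Φ : (N : ℕ) → HardSphereFlow (Torus.geometry (Fin 3)) (hsDiameter σ N) (N + 1))
    (hprob : ∀ κ ∈ Icc (0 : ℝ) 1, ∀ N, IsProbabilityMeasure (localGibbsMeasure σ (a κ) (u₀ κ) (θ₀ κ) N))
    {F : (N : ℕ) → Config (N + 1) (Fin 3) T3 → ℝ} (hFm : ∀ N, Measurable (F N)) {K : ℝ} (hK : 0 ≤ K)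
    (hFb : ∀ N, ∀ z ∈ (Φ N).good, |F N z| ≤ K * (1 + ((N + 1 : ℕ) : ℝ)⁻¹ * ∑ i, ‖(z i).2‖ ^ 2))
    {G : ℝ → ℝ} (hG : ∀ κ ∈ Icc (0 : ℝ) 1, DifferentiableWithinAt ℝ G (Icc 0 1) κ)
    (hcov : TendstoUniformlyOn (fun N κ => cov[fun z => ∑ i,
        derivWithin (fun κ' => Real.log (localGibbsProfile (a κ') (u₀ κ') (θ₀ κ') (z i))) (Icc 0 1) κ, F N;
        localGibbsMeasure σ (a κ) (u₀ κ) (θ₀ κ) N])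
      (fun κ => derivWithin G (Icc 0 1) κ) atTop (Icc 0 1))
    (h0 : Tendsto (fun N => ∫ z, F N z ∂localGibbsMeasure σ (a 0) (u₀ 0) (θ₀ 0) N) atTop (𝓝 (G 0)))
    (hvar : Tendsto (fun N => Var[F N; localGibbsMeasure σ (a 1) (u₀ 1) (θ₀ 1) N]) atTop (𝓝 0)) :
    Tendsto (fun N => ∫⁻ z, ENNReal.ofReal (|F N z - G 1| ^ 2) ∂localGibbsMeasure σ (a 1) (u₀ 1) (θ₀ 1) N)
      atTop (𝓝 0) := by
  have hmean := tendsto_integral_of_uniform_covariance ha hθ hu ha0 hθ0 σ Φ hprob hFm hK hFb hG hcov h0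
  haveI : ∀ N, IsProbabilityMeasure (localGibbsMeasure σ (a 1) (u₀ 1) (θ₀ 1) N) :=
    hprob 1 ⟨zero_le_one, le_rfl⟩
  have hmem : ∀ N, MemLp (F N) 2 (localGibbsMeasure σ (a 1) (u₀ 1) (θ₀ 1) N) := fun N =>
    memLp_two_of_good ha hθ hu ha0 hθ0 σ (Φ N) (fun κ hκ => hprob κ hκ N) ⟨zero_le_one, le_rfl⟩ (hFm N) hK (hFb N)
  exact tendsto_lintegral_sq_sub_of_variance hmem hvar hmean

end Path

/-! ## The empirical fields along the flow: measurability and energy domination -/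

section Fields

variable {ε : ℝ} {n : ℕ}

/-- The empirical density field is continuous in the configuration (continuous `χ`). [folklore] -/
theorem continuous_empiricalDensityField {χ : T3 → ℝ} (hχ : Continuous χ) :
    Continuous fun z : Config n (Fin 3) T3 => empiricalDensityField z χ := by
  have h : (fun z : Config n (Fin 3) T3 => empiricalDensityField z χ) =
      fun z => (n : ℝ)⁻¹ * ∑ i, χ (z i).1 := funext fun z => empiricalDensityField_eq_sum z χ
  rw [h]
  fun_prop

/-- The empirical momentum field is continuous in the configuration (continuous `χ`). [folklore] -/
theorem continuous_empiricalMomentumField {χ : T3 → ℝ} (hχ : Continuous χ) :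
    Continuous fun z : Config n (Fin 3) T3 => empiricalMomentumField z χ := by
  have h : (fun z : Config n (Fin 3) T3 => empiricalMomentumField z χ) =
      fun z => (n : ℝ)⁻¹ • ∑ i, χ (z i).1 • (z i).2 := funext fun z => empiricalMomentumField_eq_sum z χ
  rw [h]
  fun_prop

/-- The empirical energy field is continuous in the configuration (continuous `χ`). [folklore] -/
theorem continuous_empiricalEnergyField {χ : T3 → ℝ} (hχ : Continuous χ) :
    Continuous fun z : Config n (Fin 3) T3 => empiricalEnergyField z χ := by
  have h : (fun z : Config n (Fin 3) T3 => empiricalEnergyField z χ) =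
      fun z => (n : ℝ)⁻¹ * ∑ i, χ (z i).1 * (‖(z i).2‖ ^ 2 / 2) := funext fun z => empiricalEnergyField_eq_sum z χ
  rw [h]
  fun_prop

/-- **Energy domination of the density field along the flow** on the good set:
`|ρ_N(Φ_t z)(χ)| ≤ C (1 + n⁻¹ ∑ |vᵢ(0)|²)` for `|χ| ≤ C` (conservation of kinetic energy).
[folklore] -/
theorem abs_empiricalDensityField_flow_le (Φ : HardSphereFlow (Torus.geometry (Fin 3)) ε n)
    {χ : T3 → ℝ} {C : ℝ} (hC : ∀ x, |χ x| ≤ C) (t : ℝ) {z : Config n (Fin 3) T3} (hz : z ∈ Φ.good) :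
    |empiricalDensityField (Φ.flow t z) χ| ≤ C * (1 + (n : ℝ)⁻¹ * ∑ i, ‖(z i).2‖ ^ 2) := by
  rw [← sum_norm_vel_sq_flow Φ hz t]
  exact abs_empiricalDensityField_le _ hC

/-- Energy domination of a momentum coordinate along the flow on the good set. [folklore] -/
theorem abs_empiricalMomentumField_flow_apply_le (Φ : HardSphereFlow (Torus.geometry (Fin 3)) ε n)
    {χ : T3 → ℝ} {C : ℝ} (hC : ∀ x, |χ x| ≤ C) (t : ℝ) (j : Fin 3) {z : Config n (Fin 3) T3}
    (hz : z ∈ Φ.good) :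
    |empiricalMomentumField (Φ.flow t z) χ j| ≤ C * (1 + (n : ℝ)⁻¹ * ∑ i, ‖(z i).2‖ ^ 2) := by
  rw [← sum_norm_vel_sq_flow Φ hz t]
  exact abs_empiricalMomentumField_apply_le _ hC j

/-- Energy domination of the energy field along the flow on the good set. [folklore] -/
theorem abs_empiricalEnergyField_flow_le (Φ : HardSphereFlow (Torus.geometry (Fin 3)) ε n)
    {χ : T3 → ℝ} {C : ℝ} (hC : ∀ x, |χ x| ≤ C) (t : ℝ) {z : Config n (Fin 3) T3} (hz : z ∈ Φ.good) :
    |empiricalEnergyField (Φ.flow t z) χ| ≤ C * (1 + (n : ℝ)⁻¹ * ∑ i, ‖(z i).2‖ ^ 2) := by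
  rw [← sum_norm_vel_sq_flow Φ hz t]
  exact abs_empiricalEnergyField_le _ hC

end Fields

end Summit.AtomisticToContinuum.HydrodynamicLimit.Theorems.OneSphereInfluenceAssembly

end
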